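import Summits.ResolutionOfSingularities.ResolutionOfSingularities.Theorems.EquisingularLiftEquisingularLiftNatTowerDefs
import Summits.ResolutionOfSingularities.ResolutionOfSingularities.Theorems.EquisingularLiftEquisingularLiftNatLiftableNoseClass2Defs
import HarnessLib

/-!
# Route `EquisingularLift`, crux EL♮(3) (stmt-ResolutionOfSingularities-20148) / EL♮ (stmt-…-20038) — NON-ISOLATED side, named DOWNSTAIRS predicate
# of the lead's skeleton: rung NOSE-TOWER «a level-2 liftable-class nose, then ROUNDS along (multi)sections of the running exceptional surfaces and
# point steps» = the TOWER step constructors of …NatTowerDefs (p541504) re-based on the nose blow-up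

res-L1-w45b-lead-2 g2 (lead); draft `L/res-L1-w45b-lead-2/NOSETOWER-draft-v0.lean` (STATUS 2026-08-27T15:22:14Z). OURS; planning vocabulary of the crux
chain, not a statement of any manuscript; AI-written, weaker than expert review. PURPOSE: the next cut of the non-isolated residue `stub_elnat_three_nonisolated_nonliftclassTwo`
(child v12 / parent v15) for the census class «transversal depth ≥ 2» (PLANNER-MEMO-g10-1 C2 «nose tower»): after the nose `υ : F₂ → ℙⁿ_k` along a
class-₂ centre `Z`, the strict transform may stay singular along curves `Γ ⊆ υ⁻¹Z` mapping onto `Z` — exactly the ROUND situation of rung TOWER with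
carrier curve `Z₉ := Z`, `υ' := υ`, seed stage `F₁₀ := F₂`. So the downstairs predicate is the closure of the seed `(F₂, 𝟙, closure υ⁻¹(ι(H) ∖ Z), υ⁻¹Z, ∅)`
under `TowerPtReg F₂`, `TowerPtRam F₂`, `TowerRound ℙⁿ F₂ υ Z` (cone shadow `K = ∅`, so only Čech-witnessed rounds fire), ending REGULAR.
UPSTAIRS DEBT (honest): the nose lift is ✓ (`lift_of_isLiftableNoseClass₂`, p538681 ⇒ an `O`-SMOOTH centre, so every later stage stays `O`-smooth and
(pt-ram) never fires); the ROUNDS need «`DirStepUnobs` ⇒ the (multi)section of the exceptional ruled surface over the `O`-smooth relative curve `Z̃` lifts»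
over a base curve of ANY genus — res-type-027's T-P1VB (parts 1–13) is the genus-0 case; the general case is a NEW M–L supplier (same two-chart Čech
currency, no `Pic ℙ¹` shortcut). Registered text (if adopted): prefix of `stub_elnat_liftableNoseClassTwoThenPoints` + `ReachNoseTower k n H ι` ⇒ the EL♮
conclusion; closer = a «nose, then tower» variant of `elnat_noseThenPoints_of_liftableCentre` (p525611) over HSUB-type round suppliers.
-/

set_option linter.dupNamespace false

noncomputable section

open CategoryTheory AlgebraicGeometry TopologicalSpace
open Literature.AlgebraicGeometry.Resolution (IsBlowup)

namespace Summit.ResolutionOfSingularities.ResolutionOfSingularities.Cruxes.EquisingularLiftNat.Sections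

/-- **NOSE-TOWER (downstairs)** — a level-2 liftable-class nose `Z ⊊ ι(H)` (`IsLiftableNoseClass₂`), its blow-up `υ : F₂ → ℙⁿ_k`, then a chain of
TOWER steps over the seed `(F₂, 𝟙, closure υ⁻¹(ι(H) ∖ Z), υ⁻¹ Z, ∅)` — reduced point steps where the ambient stage is regular (`TowerPtReg`), curvilinear
fat points where it is not (`TowerPtRam`; vacuous after an `O`-smooth nose), rounds along full (multi)sections of the running exceptional surfaces over the
nose curve `Z` (`TowerRound ℙⁿ F₂ υ Z`) — reaching a stage whose reduced running strict transform is REGULAR. Downstairs only. -/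
def ReachNoseTower (k : Type) [Field k] (n : ℕ) (H : Scheme.{0})
    (ι : H ⟶ (Literature.AlgebraicGeometry.Motives.projectiveSpace n k).left) : Prop :=
  ∃ (Z : Set (Literature.AlgebraicGeometry.Motives.projectiveSpace n k).left) (hZ : IsClosed Z),
    IsLiftableNoseClass₂ k n Z ∧ Z ⊆ Set.range ι ∧ ¬ (Set.range ι ⊆ Z) ∧
    ∃ (F₂ : Scheme.{0}) (υ : F₂ ⟶ (Literature.AlgebraicGeometry.Motives.projectiveSpace n k).left),
      IsBlowup υ (Scheme.IdealSheafData.vanishingIdeal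
        (⟨Z, hZ⟩ : Closeds (Literature.AlgebraicGeometry.Motives.projectiveSpace n k).left)) ∧
      ∃ (F' : Scheme.{0}) (γ' : F' ⟶ F₂) (T' E' K' : Set F'),
        (∀ R₁ : (∀ G : Scheme.{0}, (G ⟶ F₂) → Set G → Set G → Set G → Prop),
          R₁ F₂ (𝟙 F₂) (closure (υ ⁻¹' (Set.range ι \ Z))) (υ ⁻¹' Z) ∅ →
          TowerPtReg F₂ R₁ → TowerPtRam F₂ R₁ →
          TowerRound (Literature.AlgebraicGeometry.Motives.projectiveSpace n k).left F₂ υ Z hZ R₁ →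
          R₁ F' γ' T' E' K') ∧
        Literature.AlgebraicGeometry.Resolution.Scheme.IsRegular (redSub F' (closure T') isClosed_closure)

end Summit.ResolutionOfSingularities.ResolutionOfSingularities.Cruxes.EquisingularLiftNat.Sections

end
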